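import Literature.NumberTheory.IwasawaTheory.Greenberg2006.TwistDeformationLEO
import Literature.NumberTheory.GaloisRepresentations.ProfiniteIntersectionTorsionCoefficients
import Literature.NumberTheory.EllipticCurves.IwasawaCyclotomicProofs
import Literature.NumberTheory.IwasawaTheory.PruferPontryaginDual
import HarnessLib
import Literature.NumberTheory.IwasawaTheory.WeakLeopoldtCyclotomic

/-!
# Crux `GoodLatticeBDPValue` (stmt-BirchSwinnertonDyer-19032), line `halves` v23, stub 4: the named fact (T4)
# — weak Leopoldt above `K̃_∞ ⊇ K^{cyc}` (Greenberg 2006 pp. 343–344 / Nguyen Quang Do 1984 Thm. 2.2) —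
# REDUCED IN THE KERNEL to its cyclotomic case (Iwasawa 1973; NSW (10.3.25))

Width seat `bsd-line-x1-p1-w2` (gen 7), cell `bsd-eis`, D-0154 KEY (146)/(147) row 4, item (2) INPUTS→UNCONDITIONAL;
`--supports stmt-BirchSwinnertonDyer-19032`.  Theorems + ONE inline named fact (§1) stated for relocation to
`Literature/NumberTheory/IwasawaTheory/` (D-0014 (b)); no instance, no notation, no `sorry`.

The line's stub 4 (`stub_publishedFactsGreenberg`, halves v23 9d825c14…) carries BY NAME the fact (T4)
`Greenberg2006.weakLeopoldt_H2_subsingleton_above_cyclotomic_of_isOpen` (`GaloisCohomologyStructure.lean` §5 =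
[Gr4] pp. 343–344 = [NQD84] Thm. 2.2, open-subgroup presentation): for a number field `K`, an odd prime `p`, a
finite `S ⊇ {v ∣ p}`, `ℤ_p`-extensions `κ₁, …, κ_m` and an open `U₀ ≥ N_S` (`K′ := K̄^{U₀} ⊆ K_Σ`) with
`K′K̃_∞ ⊇ K′^{cyc}` ("`χ_p` torsion on `U₀ ∩ ⋂ᵢ ker κᵢ`"), `H²(K_Σ/K′K̃_∞, D) = 0` for every discrete `D ≃ ℚ_p/ℤ_p`
with the trivial action.  Its case `m = 1`, `κ₁ = κ^{cyc}` THE cyclotomic `ℤ_p`-extension of `K`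
(`ZpExtension.IsCyclotomic`: `ker κ^{cyc} = χ_p⁻¹(μ(ℤ_p))`; `K′K^{cyc}_∞ = K′^{cyc}`, so the containment clause is
automatic) is the classical theorem of Iwasawa — the weak Leopoldt [property] HOLDS (a theorem) for the cyclotomic
`ℤ_p`-extension of every number field (Neukirch–Schmidt–Wingberg (10.3.25) with (10.3.22); [NQD84] Thm. 2.2 at
`K_∞ = k^{cyc}_∞`; [Gr4] p. 344) — typed in §1 as the named fact
`weakLeopoldt_H2_subsingleton_cyclotomic_of_isOpen` (SAME dictionary and presentation as (T4)).

* §2 plumbing: `⋂ᵢ ker (![κ])ᵢ = ker κ`; the `χ_p`-torsion clause ⟺ `U₀ ∩ ⋂ᵢ ker κᵢ ≤ ker κ^{cyc}`; the open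
  multi-layer subgroups `V_j = ⋂ᵢ κᵢ⁻¹(p^j ℤ_p) ≥ ⋂ᵢ ker κᵢ` with `⋂ⱼ V_j = ⋂ᵢ ker κᵢ` (`⋂ⱼ p^j ℤ_p = 0`);
  `U₀ ∩ ⋂ᵢ ker κᵢ = ⋂ⱼ (U₀ ∩ V_j ∩ ker κ^{cyc})`; `galoisGroupAbove S` commutes with intersections of subgroups
  containing `N_S`; every element of a group `≃+ ℚ_p/ℤ_p` has finite order.
* §3 `cyclotomic_of_above_cyclotomic` — (T4) ⟹ §1 (the special case); and
  **`above_cyclotomic_of_cyclotomic` — §1 ⟹ (T4)**: `Gal(K_Σ/K′K̃_∞) = ⋂ⱼ Gal(K_Σ/K′_j K^{cyc}_∞)` over the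
  layers `K′_j = K̄^{U₀ ∩ V_j}` of `K′K̃_∞/K′`, each `H²(K_Σ/K′_j K^{cyc}_∞, D)` vanishes by §1 at the open subgroup
  `U₀ ∩ V_j ≥ N_S`, and `H²` of a decreasing intersection of closed subgroups of the profinite `G_{K,S}` with discrete
  torsion coefficients vanishes when it does at every stage (the tree's
  `GaloisRepresentations.subsingleton_H2_trivial_iInf_of_forall`, Serre I §2.2 Prop. 8 — landed for this purpose).

EFFECT (the LEAD's call, nothing reshaped here): (T4) and §1 are EQUIVALENT by name, so stub 4 may carry the
cyclotomic statement §1 instead of (T4) (research statement [NQD84] → Iwasawa's theorem / NSW (10.3.25));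
`publishedFactsGreenberg_of_textbook … (above_cyclotomic_of_cyclotomic h)` recovers the v22 text.  WHAT IS NOT HERE:
a proof of §1 — the Brauer-group part of `H²(G_S(F), μ_{p^n})` dies in the cyclotomic tower by the tree's
`GaloisCohomology.exists_resH_layerSubgroup_mu_primePow_eq_zero` / `CyclotomicTowerMuKilling`, but the
`S`-ideal-class part (`ker(inf²) = H¹(G_S(F), (K_S^×)^{p^n})`, NSW (8.3.11) (ii), principal ideal theorem / the
`G_S` class formation) is not in the tree; sized XL.  HONEST FRAMING: a reduction between two published
statements plus profinite cohomology; no case of weak Leopoldt, of KY Thm. 2.2.2, of the crux or of BSD is proved.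

References: [Greenberg2006] pp. 341–344; [NguyenQuangDo1984] Déf. 2.1, Thm. 2.2; [Iwasawa1973];
[NeukirchSchmidtWingberg2008] (10.3.22), (10.3.25), (8.3.11); [Washington1997] §13.1; [SerreGaloisCohomology1997]
I §2.2 Prop. 8.
-/

-- D-0017: single-problem summit, the namespace repeats the problem name by design.
set_option linter.dupNamespace false
set_option autoImplicit false

noncomputable section

open scoped Classical
open NumberField IsDedekindDomain Field
open Literature.NumberTheory.GaloisRepresentations
open Literature.NumberTheory.EllipticCurves (ZpExtension)
open Literature.NumberTheory.IwasawaTheory Literature.NumberTheory.IwasawaTheory.Greenberg2006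

namespace Summit.BirchSwinnertonDyer.BirchSwinnertonDyer.Theorems.GoodLatticeBDPValueT4OfCyclotomic

/-- Transport of the vanishing `H²(H, D) = 0` (trivial coefficients) along an EQUALITY of subgroups
`H₁ = H₂` of a topological group (the subgroup enters the type of the cohomology group; same device as
the private `subsingleton_H2_trivial_congr` of `GaloisCohomologyStructure.lean`). [folklore] -/
private theorem subsingleton_H2_trivial_subgroup_congr {G : Type} [Group G] [TopologicalSpace G]
    [IsTopologicalGroup G] {R : Type} [CommRing R] [TopologicalSpace R] [IsTopologicalRing R]
    {D : Type} [AddCommGroup D] [Module R D] [TopologicalSpace D] [DiscreteTopology D]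
    [ContinuousSMul R D] {H₁ H₂ : Subgroup G} (e : H₁ = H₂)
    (h : Subsingleton ((ContinuousRep.trivial H₁ R D).H 2)) :
    Subsingleton ((ContinuousRep.trivial H₂ R D).H 2) := by
  subst e
  exact h

/-! ### §1. The named fact: weak Leopoldt for the CYCLOTOMIC `ℤ_p`-extension, open-subgroup form -/

/-- Reading §1: every class is `0`. [cite: NeukirchSchmidtWingberg2008, (10.3.25)] -/
theorem Literature.NumberTheory.IwasawaTheory.weakLeopoldt_H2_subsingleton_cyclotomic_of_isOpen.eq_zero
    (h : Literature.NumberTheory.IwasawaTheory.weakLeopoldt_H2_subsingleton_cyclotomic_of_isOpen)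
    {K : Type} [Field K] [NumberField K] {p : ℕ} [Fact p.Prime] (hp : p ≠ 2)
    {S : Set (HeightOneSpectrum (𝓞 K))} (hSf : S.Finite)
    (hS : ∀ v : HeightOneSpectrum (𝓞 K), ((p : ℕ) : 𝓞 K) ∈ v.asIdeal → v ∈ S)
    {κ : ZpExtension K p} (hκ : κ.IsCyclotomic) {U₀ : Subgroup (absoluteGaloisGroup K)}
    (hU₀ : IsOpen (U₀ : Set (absoluteGaloisGroup K))) (hN : ramificationSubgroup K S ≤ U₀)
    {R : Type} [CommRing R] [TopologicalSpace R] [IsTopologicalRing R]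
    {D : Type} [AddCommGroup D] [Module R D] [TopologicalSpace D] [DiscreteTopology D]
    [ContinuousSMul R D] (hD : Nonempty (D ≃+ ℚ_[p] ⧸ (PadicInt.subring p).toAddSubgroup))
    (c : (ContinuousRep.trivial (galoisGroupAbove S (U₀ ⊓ κ.kerSubgroup)) R D).H 2) : c = 0 :=
  haveI := h K p hp S hSf hS κ hκ U₀ hU₀ hN R D hD
  Subsingleton.elim c 0

/-! ### §2. Plumbing: `⋂ᵢ ker κᵢ` for `m = 1`; the `χ_p`-torsion clause; the layers -/

section Plumbing

variable {K : Type} [Field K] {p : ℕ} [Fact p.Prime]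

/-- For a single `ℤ_p`-extension, `⋂ᵢ ker (![κ])ᵢ = ker κ`. [cite: Greenberg2006, p. 341 L39–45] -/
theorem multiZpKer_singleton (κ : ZpExtension K p) : multiZpKer p ![κ] = κ.kerSubgroup := by
  ext σ
  simp [mem_multiZpKer_iff, ZpExtension.mem_kerSubgroup]

/-- **The `χ_p`-torsion clause of (T4) says `U₀ ∩ ⋂ᵢ ker κᵢ ≤ ker κ^{cyc}`** for the cyclotomic
`ℤ_p`-extension `κ^{cyc}` (`IsCyclotomic`: `ker κ^{cyc} = χ_p⁻¹(μ(ℤ_p))`).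
[cite: Greenberg2006, pp. 343–344] [cite: Washington1997, §13.1] -/
theorem inf_multiZpKer_le_kerSubgroup_of_isCyclotomic {m : ℕ} (κ : Fin m → ZpExtension K p)
    (U₀ : Subgroup (absoluteGaloisGroup K)) {κ₀ : ZpExtension K p} (hκ₀ : κ₀.IsCyclotomic)
    (hcyc : ∀ σ : absoluteGaloisGroup K, σ ∈ U₀ ⊓ multiZpKer p κ →
      GaloisRep.cyclotomicCharacter K p σ ∈ CommGroup.torsion ℤ_[p]ˣ) :
    U₀ ⊓ multiZpKer p κ ≤ κ₀.kerSubgroup := by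
  intro σ hσ
  have h : κ₀.kerSubgroup = (CommGroup.torsion ℤ_[p]ˣ).comap
      (GaloisRep.cyclotomicCharacter K p).toMonoidHom := hκ₀
  rw [h, Subgroup.mem_comap]
  exact hcyc σ hσ

/-- Conversely, on `ker κ^{cyc}` the cyclotomic character is torsion. [cite: Washington1997, §13.1] -/
theorem cyclotomicCharacter_mem_torsion_of_mem_kerSubgroup {κ₀ : ZpExtension K p}
    (hκ₀ : κ₀.IsCyclotomic) {σ : absoluteGaloisGroup K} (hσ : σ ∈ κ₀.kerSubgroup) :
    GaloisRep.cyclotomicCharacter K p σ ∈ CommGroup.torsion ℤ_[p]ˣ := by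
  have h : κ₀.kerSubgroup = (CommGroup.torsion ℤ_[p]ˣ).comap
      (GaloisRep.cyclotomicCharacter K p).toMonoidHom := hκ₀
  rw [h, Subgroup.mem_comap] at hσ
  exact hσ

/-- An element of `ℤ_p` divisible by every power of `p` is `0`. [folklore] -/
private theorem padicInt_eq_zero_of_forall_pow_dvd {x : ℤ_[p]} (hx : ∀ n : ℕ, (p : ℤ_[p]) ^ n ∣ x) : x = 0 := by
  by_contra h0
  have hpos : 0 < ‖x‖ := norm_pos_iff.mpr h0
  -- `‖x‖ ≤ p^{-n}` for every `n`
  have hle : ∀ n : ℕ, ‖x‖ ≤ (p : ℝ) ^ (-(n : ℤ)) := fun n ↦ by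
    rw [PadicInt.norm_le_pow_iff_mem_span_pow]
    exact Ideal.mem_span_singleton.mpr (hx n)
  have hp1 : (1 : ℝ) < p := by exact_mod_cast (Fact.out : p.Prime).one_lt
  -- choose `n` with `p^{-n} < ‖x‖`
  obtain ⟨n, hn⟩ := exists_pow_lt_of_lt_one hpos (inv_lt_one_of_one_lt₀ hp1)
  have h' : (p : ℝ) ^ (-(n : ℤ)) = ((p : ℝ)⁻¹) ^ n := by
    rw [zpow_neg, zpow_natCast, inv_pow]
  exact absurd (hle n) (by rw [h']; exact not_le.mpr hn)

/-- The **multi-layer subgroup** `V_j = ⋂ᵢ κᵢ⁻¹(p^j ℤ_p) ≤ Γ_K` (`Gal(K̄/K̃_j)`, `K̃_j` the compositum of the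
`j`-th layers) is open. [cite: Greenberg2006, p. 341 L39–45] [cite: Washington1997, §13.1] -/
theorem isOpen_multiLayer {m : ℕ} (κ : Fin m → ZpExtension K p) (j : ℕ) :
    IsOpen ((⨅ i, (κ i).layerSubgroup j : Subgroup (absoluteGaloisGroup K)) : Set (absoluteGaloisGroup K)) := by
  rw [Subgroup.coe_iInf]
  exact isOpen_iInter_of_finite fun i ↦ (κ i).isOpen_layerSubgroup j

/-- `V_j` decreases with `j`. [cite: Washington1997, §13.1] -/
theorem multiLayer_antitone {m : ℕ} (κ : Fin m → ZpExtension K p) :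
    Antitone fun j ↦ (⨅ i, (κ i).layerSubgroup j : Subgroup (absoluteGaloisGroup K)) :=
  fun _ _ hjk ↦ iInf_mono fun i ↦ (κ i).layerSubgroup_antitone hjk

/-- `⋂ᵢ ker κᵢ ≤ V_j`. [cite: Washington1997, §13.1] -/
theorem multiZpKer_le_multiLayer {m : ℕ} (κ : Fin m → ZpExtension K p) (j : ℕ) :
    multiZpKer p κ ≤ ⨅ i, (κ i).layerSubgroup j :=
  iInf_mono fun i ↦ (κ i).kerSubgroup_le_layerSubgroup j

/-- `⋂ⱼ V_j = ⋂ᵢ ker κᵢ` (`⋂ⱼ p^j ℤ_p = 0`). [cite: Washington1997, §13.1] -/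
theorem iInf_multiLayer {m : ℕ} (κ : Fin m → ZpExtension K p) :
    ⨅ j, (⨅ i, (κ i).layerSubgroup j : Subgroup (absoluteGaloisGroup K)) = multiZpKer p κ := by
  refine le_antisymm (fun σ hσ ↦ ?_) (le_iInf fun j ↦ multiZpKer_le_multiLayer κ j)
  rw [Subgroup.mem_iInf] at hσ
  rw [mem_multiZpKer_iff]
  intro i
  have hdvd : ∀ j : ℕ, (p : ℤ_[p]) ^ j ∣ (κ i σ).toAdd := fun j ↦
    ZpExtension.mem_layerSubgroup.mp (Subgroup.mem_iInf.mp (hσ j) i)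
  have h0 := padicInt_eq_zero_of_forall_pow_dvd hdvd
  rw [← toAdd_one] at h0
  exact Multiplicative.toAdd.injective h0

/-- **`U₀ ∩ ⋂ᵢ ker κᵢ = ⋂ⱼ (U₀ ∩ V_j ∩ ker κ^{cyc})`** once `U₀ ∩ ⋂ᵢ ker κᵢ ≤ ker κ^{cyc}`.
[cite: NguyenQuangDo1984, Thm. 2.2 (proof)] -/
theorem inf_multiZpKer_eq_iInf {m : ℕ} (κ : Fin m → ZpExtension K p)
    (U₀ : Subgroup (absoluteGaloisGroup K)) (κ₀ : ZpExtension K p)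
    (hle : U₀ ⊓ multiZpKer p κ ≤ κ₀.kerSubgroup) :
    U₀ ⊓ multiZpKer p κ = ⨅ j, ((U₀ ⊓ ⨅ i, (κ i).layerSubgroup j) ⊓ κ₀.kerSubgroup) := by
  refine le_antisymm (le_iInf fun j ↦ le_inf (inf_le_inf_left U₀ (multiZpKer_le_multiLayer κ j)) hle)
    (fun σ hσ ↦ ?_)
  rw [Subgroup.mem_iInf] at hσ
  have h2 : σ ∈ multiZpKer p κ := by
    rw [← iInf_multiLayer κ, Subgroup.mem_iInf]
    exact fun j ↦ (Subgroup.mem_inf.mp (Subgroup.mem_inf.mp (hσ j)).1).2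
  exact Subgroup.mem_inf.mpr ⟨(Subgroup.mem_inf.mp (Subgroup.mem_inf.mp (hσ 0)).1).1, h2⟩

end Plumbing

/-! ### §2b. `galoisGroupAbove S` commutes with intersections of subgroups containing `N_S` -/

section Above

variable {K : Type} [Field K] (S : Set (HeightOneSpectrum (𝓞 K)))

/-- **`Gal(K_Σ/⋃ⱼ K_j) = ⋂ⱼ Gal(K_Σ/K_j)` inside `G_{K,S}`**: the image in `Γ_K/N_S` of an intersection
of subgroups CONTAINING `N_S` is the intersection of the images. [cite: Greenberg2006, p. 342 (display (2))] -/
theorem galoisGroupAbove_iInf {ι : Sort*} [Nonempty ι] (W : ι → Subgroup (absoluteGaloisGroup K))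
    (hW : ∀ i, ramificationSubgroup K S ≤ W i) :
    galoisGroupAbove S (⨅ i, W i) = ⨅ i, galoisGroupAbove S (W i) := by
  refine le_antisymm (le_iInf fun i ↦ Subgroup.map_mono (iInf_le W i)) fun g hg ↦ ?_
  rw [Subgroup.mem_iInf] at hg
  obtain ⟨σ, rfl⟩ := toUnramifiedQuot_surjective K S g
  refine (mem_galoisGroupAbove_iff S _ _).mpr ⟨σ, ?_, rfl⟩
  rw [Subgroup.mem_iInf]
  intro i
  obtain ⟨τ, hτ, hτσ⟩ := (mem_galoisGroupAbove_iff S _ _).mp (hg i)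
  -- `τ⁻¹ σ ∈ N_S ≤ W i`
  have h1 : toUnramifiedQuot K S (τ⁻¹ * σ) = 1 := by
    rw [map_mul, map_inv, hτσ, inv_mul_cancel]
  have hmem : τ⁻¹ * σ ∈ ramificationSubgroup K S := (QuotientGroup.eq_one_iff _).mp h1
  simpa using (W i).mul_mem hτ (hW i hmem)

end Above

/-! ### §3. (T4) ⟺ the cyclotomic case -/

section Reduction

/-- **(T4) ⟹ §1**: the cyclotomic statement is the case `m = 1`, `κ₁ = κ^{cyc}` of
`weakLeopoldt_H2_subsingleton_above_cyclotomic_of_isOpen` (the `χ_p`-torsion clause holds on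
`ker κ^{cyc} = χ_p⁻¹(μ(ℤ_p))`). [cite: Greenberg2006, pp. 343–344] [cite: NguyenQuangDo1984, Thm. 2.2] -/
theorem cyclotomic_of_above_cyclotomic
    (h : weakLeopoldt_H2_subsingleton_above_cyclotomic_of_isOpen) :
    Literature.NumberTheory.IwasawaTheory.weakLeopoldt_H2_subsingleton_cyclotomic_of_isOpen := by
  intro K _ _ p _ hp S hSf hS κ hκ U₀ hU₀ hN R _ _ _ D _ _ _ _ _ hD
  have h' := h K p hp S hSf hS 1 ![κ] U₀ hU₀ hN (fun σ hσ ↦ ?_) R D hD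
  · exact subsingleton_H2_trivial_subgroup_congr
      (congrArg (fun H ↦ galoisGroupAbove S (U₀ ⊓ H)) (multiZpKer_singleton κ)) h'
  · have hσ' : σ ∈ κ.kerSubgroup := by
      rw [← multiZpKer_singleton κ]; exact hσ.2
    exact cyclotomicCharacter_mem_torsion_of_mem_kerSubgroup hκ hσ'

/-- **Every element of a group additively isomorphic to `ℚ_p/ℤ_p` has finite order.** [folklore] -/
private theorem isTorsion_of_addEquiv_quotientSubring {p : ℕ} [Fact p.Prime] {D : Type} [AddCommGroup D]
    (e : D ≃+ ℚ_[p] ⧸ (PadicInt.subring p).toAddSubgroup) : AddMonoid.IsTorsion D := by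
  intro d
  set x : QpModZp p := (QpModZp.addEquivQuotientSubring p).symm (e d) with hx
  obtain ⟨k, hk⟩ := QpModZp.exists_pow_nsmul_eq_zero (p := p) x
  refine isOfFinAddOrder_iff_nsmul_eq_zero.mpr ⟨p ^ k, pow_pos (Fact.out : p.Prime).pos k, ?_⟩
  apply e.injective
  apply (QpModZp.addEquivQuotientSubring p).symm.injective
  rw [map_nsmul, map_nsmul, ← hx, hk, map_zero, map_zero]

/-- **§1 ⟹ (T4): weak Leopoldt above a `ℤ_p^m`-extension containing the cyclotomic one FOLLOWS from
the cyclotomic case** ([NQD84]'s reduction: `Gal(K_Σ/K′K̃_∞) = ⋂ⱼ Gal(K_Σ/K′_j K^{cyc}_∞)` over the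
layers `K′_j` of `K′K̃_∞/K′`, and `H²` of a decreasing intersection of closed subgroups of the
profinite `G_{K,S}` with discrete torsion coefficients vanishes when it vanishes at every stage,
Serre I §2.2 Prop. 8). [cite: NguyenQuangDo1984, Thm. 2.2] [cite: Greenberg2006, pp. 343–344]
[cite: NeukirchSchmidtWingberg2008, (10.3.25)] [cite: SerreGaloisCohomology1997, I §2.2 Prop. 8] -/
theorem above_cyclotomic_of_cyclotomic
    (h : Literature.NumberTheory.IwasawaTheory.weakLeopoldt_H2_subsingleton_cyclotomic_of_isOpen) :
    weakLeopoldt_H2_subsingleton_above_cyclotomic_of_isOpen := by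
  intro K _ _ p _ hp S hSf hS m κ U₀ hU₀ hN hcyc R _ _ _ D _ _ _ _ _ hD
  -- the cyclotomic `ℤ_p`-extension of `K`
  obtain ⟨κ₀, hκ₀⟩ := Literature.NumberTheory.EllipticCurves.ZpExtension.exists_isCyclotomic_holds K p
    (GaloisRep.cyclotomicCharacter_range_infinite K p)
  have hle : U₀ ⊓ multiZpKer p κ ≤ κ₀.kerSubgroup :=
    inf_multiZpKer_le_kerSubgroup_of_isCyclotomic κ U₀ hκ₀ hcyc
  -- the stages `W_j = U₀ ∩ V_j ∩ ker κ₀` and their images in `G_{K,S}`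
  set W : ℕ → Subgroup (absoluteGaloisGroup K) :=
    fun j ↦ (U₀ ⊓ ⨅ i, (κ i).layerSubgroup j) ⊓ κ₀.kerSubgroup
    with hW
  have hNW : ∀ j, ramificationSubgroup K S ≤ W j := fun j ↦
    le_inf (le_inf hN ((ramificationSubgroup_le_multiZpKer S p κ hS).trans (multiZpKer_le_multiLayer κ j)))
      ((ramificationSubgroup_le_multiZpKer S p ![κ₀] hS).trans (multiZpKer_singleton κ₀).le)
  have hWanti : Antitone W := fun j k hjk ↦
    inf_le_inf_right _ (inf_le_inf_left _ (multiLayer_antitone κ hjk))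
  have hWcl : ∀ j, IsClosed ((W j : Subgroup (absoluteGaloisGroup K)) : Set (absoluteGaloisGroup K)) :=
    fun j ↦ ((Subgroup.isClosed_of_isOpen U₀ hU₀).inter
      (Subgroup.isClosed_of_isOpen _ (isOpen_multiLayer κ j))).inter κ₀.isClosed_kerSubgroup
  -- each stage: §1 at the open subgroup `U₀ ∩ V_j ⊇ N_S`
  have hstage : ∀ j, Subsingleton ((ContinuousRep.trivial (galoisGroupAbove S (W j)) R D).H 2) :=
    fun j ↦ h K p hp S hSf hS κ₀ hκ₀ (U₀ ⊓ ⨅ i, (κ i).layerSubgroup j) (hU₀.inter (isOpen_multiLayer κ j))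
      (le_inf hN ((ramificationSubgroup_le_multiZpKer S p κ hS).trans (multiZpKer_le_multiLayer κ j)))
      R D hD
  -- the limit lemma in the profinite group `G_{K,S}`
  haveI : TotallyDisconnectedSpace (GaloisGroupUnramifiedOutside K S) :=
    totallyDisconnectedSpace_galoisGroupUnramifiedOutside S
  have hlim : Subsingleton
      ((ContinuousRep.trivial (⨅ j, galoisGroupAbove S (W j) :
        Subgroup (GaloisGroupUnramifiedOutside K S)) R D).H 2) :=
    subsingleton_H2_trivial_iInf_of_forall (isTorsion_of_addEquiv_quotientSubring hD.some)
      (fun j ↦ galoisGroupAbove S (W j)) (fun j k hjk ↦ Subgroup.map_mono (hWanti hjk))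
      (fun j ↦ isClosed_galoisGroupAbove S (W j) (hWcl j)) hstage
  -- transport along `Gal(K_Σ/K′K̃_∞) = ⋂ⱼ Gal(K_Σ/K′_j K^{cyc}_∞)`
  have heq : (⨅ j, galoisGroupAbove S (W j)) = galoisGroupAbove S (U₀ ⊓ multiZpKer p κ) := by
    rw [inf_multiZpKer_eq_iInf κ U₀ κ₀ hle, galoisGroupAbove_iInf S W hNW]
  exact subsingleton_H2_trivial_subgroup_congr heq hlim

end Reduction

end Summit.BirchSwinnertonDyer.BirchSwinnertonDyer.Theorems.GoodLatticeBDPValueT4OfCyclotomic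

end
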